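import Summits.ResolutionOfSingularities.ResolutionOfSingularities.Theorems.WildReflectionLU3
import HarnessLib

/-!
# WildLogDiagonalLU — decomp-res node «LogDiagonalCut» (lens-1 g32, door (W-wild-PROD) of critic letters 229a / 229b,
ROW 234): the BINOMIAL LOG-DIAGONAL wild `ℤ/p` cell `WildLogDiagonalLUAbove k O`, decided HYPOTHESIS-FREE by
PRODUCTION — the kernel BUILDS the pseudo-reflection model (toric chart + Frobenius normal form + Nakayama +
derivation rule) from the typed action data `(x′, a′, N, p)` and then calls the g31 law
`WildReflectionLU.relLU_of_wildPseudoReflectionLUAbove` (= [KiralyLutkebohmert2013, Thm. 2 (a) ⇒ (d)] from the tree)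
BY NAME; the located residual `R33`, the exact cut `R32 ↔ R33`, ROOT BY NAME `closes_logDiag`

THESIS.  After g31 («ReflectionCut») the wild axis of the residual is LOCATED at: «produce, above every f.g. model
below, a `G`-stable regular model upstairs on which the prime-order generator is a PSEUDO-REFLECTION» — g31's cell
`WildPseudoReflectionLUAbove` ASSUMES that model (its clause «`g b − b ∈ (g y − y)·B` for all `b`» IS
Király–Lütkebohmert's condition (a)), and descends.  This node removes the assumption for a typed KIND of wild
actions: the generator acts on a FRAME `x′₁ … x′_d` of a regular model BINOMIALLY LOG-DIAGONALLY,
`g x′_j = x′_j·(1 + η)^{N_j}` with `η = w·∏ x′_j^{a′_j}` a frame monomial up to a unit (the shape of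
[KiralyLutkebohmert2013, Ex. 6, p. 66] `σ(x) = x(1 + y)^{-1}`, of the g31 arc and golden instances, and of every
Perron / Jacobi–Perron chart of them), and the twist vector is `p`-LUCKY (`Lucky p N a′`, ARITHMETIC in
`(N, a′, p)` only: the `p`-adic valuation of `N` is attained at exactly one coordinate `j₀`, and the pivot passes
through `x′_{j₀}` as soon as another coordinate moves).  For such data the kernel PRODUCES the pseudo-reflection:
in characteristic `p`, `(1 + η)^{p^e m} − 1 = η^{p^e}·c` with `c ≡ m` a UNIT for `p ∤ m` (FROBENIUS NORMAL FORM,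
`exists_one_add_zpow_sub_one_eq` — the place where `([K′:K] : k) = 0` is USED), so the augmentation of `x′_j` is
`x′_j η^{p^{v_p N_j}}·(unit)`, and luck makes `δ := g x′_{j₀} − x′_{j₀}` DIVIDE every `g x′_j − x′_j` in the local
ring (`exists_twist_eq_mul_of_lucky`); the DERIVATION RULE `I(ab) = I(a)·g b + a·I(b)` spreads «`g z − z ∈ δ·B′`»
over the subring generated (`apply_sub_mem_of_mem_closure`), NAKAYAMA spreads it from the parameters `x` of the old
centre to the whole old local ring (`exists_apply_sub_eq_sum`: residues fixed + `g 𝔪 ⊆ 𝔪` give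
`I_G B ⊆ Σ_i (g xᵢ − xᵢ)B + 𝔪·I_G B`), and the CHART `M′ = M[x′, (1 + gⁱη)⁻¹ : i < p]` is `g`-stable, dominated
by `O′`, REGULAR of dimension `d` at the centre by the tree's toric theorem
`isRegularLocalRing_locAtCentre_adjoin_monomials` (+ `ringKrullDim_locAtCentre_closure_eq`,
`locAtCentre_closure_locAtCentre_union`, `isUniversallyCatenaryRing_locAtCentre_closure`) BY NAME
(`chart_isRegularLocalRing_and_generates`).  Hence `wildPseudoReflectionLUAbove_of_wildLogDiagonalLUAbove` and the
HYPOTHESIS-FREE LAW `relLU_of_wildLogDiagonalLUAbove : WildLogDiagonalLUAbove k O → RelLocalUniformization k K O`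
(every `d`, every `p`, ONE call of the g31 law, nothing of KL13 / toric regularity re-proved).

§1 THE CELL `WildLogDiagonalLUAbove k O` (PART C), clause by clause.  TOP = g31's W1–W3 VERBATIM: `K′/K` finite
Galois inside `AlgebraicClosure K`, `[K′:K]` PRIME, `([K′:K] : k) = 0`; `O′` above `O`, `G`-STABLE; RESIDUES IN `k`
upstairs (g25 verbatim).  STANDARD MODEL CLAUSE (g31 verbatim): `∀ R` f.g. birational `≤ O`, `∃ t₀`,
`M := modelAbove k R K′ t₀ ≤ O′`, `G`-stable, `B := locAtCentre M O′` regular — carrying INSIDE the same `∃ t₀`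
ONLY TYPED DATA of the action on THAT model's named frame (no clause on unnamed models, no principal-augmentation /
fixed-locus / quotient wording): (F1) `ringKrullDim B = d`; (F2) `x : Fin d → K′` in the centre of `B`;
(F3) `x` generates the centre (`∀ b ∈ B, v′b < 1 → b = Σ cᵢ xᵢ`, `cᵢ ∈ B`) — with (F1) an r.s.p.; (F4) the FRAME
`x′ : Fin d → K′`: non-zero, in `𝔪_{O′}`, fractions of `M`; (F5) `xᵢ = ∏_j x′_j^{A i j}`, `A : Fin d → Fin d → ℕ`
(a monomial chart; `A = 1` allowed — Cell(A) ⟺ Cell(A = 1), letter 229b (Q2): the A-form is kept so that instances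
read their Perron charts off `A`); (P) PIVOT `η ∈ M`, `v′η < 1`, `w ∈ B`, `v′w = 1`, `η = w·∏ x′_j^{a′_j}`;
(T) BINOMIAL LOG-DIAGONAL ACTION of a named `g : K′ ≃ₐ[K] K′` on the frame: `g x′_j = x′_j·(1 + η)^{N_j}`,
`N : Fin d → ℤ`; (L) `Lucky [K′:K] N a′`.  `Lucky p N a′` (PART A) := `∃ j₀ e₀` (bounded by `|N_{j₀}|`),
`p ∤ N_{j₀}/p^{e₀}`, `N_{j₀} = p^{e₀}·(N_{j₀}/p^{e₀})`, `∀ j ≠ j₀, p^{e₀+1} ∣ N_j ∧ (N_j ≠ 0 → 1 ≤ a′_{j₀})` —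
DECIDABLE (`unfold Lucky; decide` evaluates it; `lucky_iff_exists` is the free form).  WHY PER MODEL (letter 229b
(q1c)): the kernel has no cofinality theorem for monomial ladders when `d ≥ 3` or the top is not Abhyankar (the
arc instance), and a translation of the frame destroys binomial shape (census (c)); so shape + luck are typed on the
cofinal models the standard clause already names, exactly as g31 typed its clause there.

§2 WHAT LUCK MEANS (letter 229b (q1b), honest logical status).  On the PRODUCED chart `B′ = M′_𝔪′` the augmentation
ideal is generated (derivation rule + Nakayama) by the `x′_j((1 + η)^{N_j} − 1) = x′_j η^{p^{v_p N_j}}·(unit)` and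
`I((1 + gⁱη)⁻¹) ∈ I(η)·B′`; a principal ideal of a local ring is generated by ONE of any generating set, and
monomials in the r.s.p. `x′` of the regular ring `B′` divide each other iff exponentwise; so ON A BINOMIAL CHART:
LUCKY ⟺ `I_G·B′` principal ⟺ [KiralyLutkebohmert2013, Thm. 2] (a)–(e) (kernel: ⇒, `exists_twist_eq_mul_of_lucky`
+ `chart_isRegularLocalRing_and_generates`; ⇐: desk, exponent comparison).  (L) is thus the DECIDABLE READING of
KL (c) in the binomial normal form, computed from `(N, a′, p)` — not an independent invariant; the cell is registered
as «binomial log-diagonal ∧ PR-cofinal, PR READ OFF ARITHMETIC», a WEAKER split of the wild `ℤ/p` kind whose value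
is the PRODUCTION (chart + Frobenius + Nakayama + derivation) replacing g31's model-side PR clause.

§3 TOY CENSUS (desk; chart rule `(N, a′) ↦ (A⁻¹N, Aᵀa′)`).  (a) RANK-2 MONOMIAL FAMILY `k(u, η, …)`,
`g η = η/(1 + η)`, `v′ = (1, γ)` monomial: depth 0 frame `(u, η, …)`, `N = (0, −1, 0…)`, `a′ = e_η` ⇒ LUCKY ⇒ PR
(`y = η`).  ERRATUM to g31 NEXT-g32 l.2 («no regular `G`-model is PR in the `d = 2` toy»): false at depth 0 —
`k[u, η]_{(u,η)}` IS a pseudo-reflection model; the sentence is correct for the models BELOW the first Perron step,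
which is what the CONTROL uses.  Perron chart of depth `n ≥ 1`: frame `(m₁, m₂, …)`, `(u, η) = (m₁, m₂)^{A_n}`
with continuant entries, twists `N = ±(q, −q′)` by CONSECUTIVE CONTINUANTS (coprime), `a′` = the `η`-row of `A_n`
(entries `≥ 1`) ⇒ LUCKY ⟺ `v_p(q) ≠ v_p(q′)` ⟺ `p ∣ q q′` = g31's registry criterion R1 EXACTLY; PR charts cofinal
iff `p` divides infinitely many continuants (golden `γ`: every `p`; every `γ` for `p = 2, 3`).  (b) RANK-3 FAMILY
`k(u, η₁, η₂, …)`, `g η₁ = η₁/(1 + η₁)`, `g η₂ = η₂/(1 + η₁)^c`: depth 0 `N = (0, −1, −c, 0…)`, `a′ = e_{η₁}` ⇒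
LUCKY ⟺ `c = 0 ∨ p ∣ c`; SHARP at `c = 1`: `I(η₁) = −η₁²/(1 + η₁)`, `I(η₂) = −η₁η₂/(1 + η₁)`,
`I_G·B = η₁·(η₁, η₂)` NOT principal; on Jacobi–Perron charts LUCKY reads «after dividing by `p^{v_p N}` exactly one
coordinate is `≢ 0 (mod p)` and the pivot meets it» — uniform in every rank (g31's «`p` divides a column» is its
`d = 2` face).  (c) MIXED UNITS `g x₁ = x₁(1 + η)`, `g x₂ = x₂(1 + η + η²x₃)`, `p > 2`: on the chart column
`(p − 1, 1)` the augmentation `(1 + η)^{p−1}(1 + η + η²x₃) − 1` has initial form `η²x₃` — NO `p`-adic normal form;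
the KIND IS CUT AT BINOMIAL SHAPE (KILL clause of NEXT-g32 honoured) and the mixed-unit tops are the typed complement
`WildLogDiagonalMixedAbove` (PART C′).

§4 INSTANCES (by hand, every clause; the Lucky clauses are certified by `unfold Lucky; decide` in bc/Probe.lean).
(4a) g31's ARC instance (rr 1, `d = 4`, `K = 𝔽_p(t, y₁, y₂, y₃)`, `θ^p − θ = 1/t`, `π = 1/θ`, `g π = π/(1 + π)`,
`O′` the non-Abhyankar arc place of g31): W1–W3, residues, model clause = g31's verification verbatim; on each of
those models: frame `x′ = x = (π, z₁, z₂, z₃)` (`zᵢ ∈ K` fixed), `A = 1`, `η = π` (`w = 1`, `a′ = e_π`),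
`N = (−1, 0, 0, 0)`, LUCKY with `j₀ = π`, `e₀ = 0`, `m₀ = −1` (all other twists `0`) — at EVERY depth.
(4b) g31's GOLDEN instance (rr 2, `g η = η/(1 + η)`, `v′(u, η) = (1, φ)`): depth-`n` Perron frame `(m₁, m₂, z…)`,
`A` = the continuant matrix, `η = m₁^{a′₁} m₂^{a′₂}` (`a′ ≥ 1`), `N = ±(F, −F′)` consecutive Fibonacci numbers,
LUCKY ⟺ `p ∣ F F′` — cofinal for every `p`; e.g. `p = 2`, `(F, F′) = (2, 3)`: `j₀` = the coordinate twisted by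
`∓3`, `e₀ = 0`, `m₀ = ∓3`, `2^1 ∣ ±2`, `a′_{j₀} ≥ 1` (`Lucky 2 ![2, -3] ![1, 1]` by `decide`).  (4c) the rank-3 top
of §3 (b) with `p ∣ c`, depth 0: `N = (0, −1, −c, 0)`, `j₀ = η₁`, `e₀ = 0`, `m₀ = −1`, `p ∣ c`, `a′_{η₁} = 1`
(`Lucky 7 ![0, -1, -49, 0] ![0, 1, 0, 0]` by `decide`).

§5 CONTROL and COMPLEMENTS.  CONTROL = §3 (a) with `p = 5`, `γ = [0; 3, 1̄]`: binomial shape at every depth, LUCKY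
at NO depth `≥ 1` — KERNEL CERTIFICATE (PART D): the continuants are the Lucas numbers `L_{n+1} = F_{n+2} + F_n`,
`lucas_mod_five` (residues cycle `1, 3, 4, 2`), `five_not_dvd_lucas`, `not_lucky_of_not_dvd_two`,
`control_not_lucky : ¬ Lucky 5 ![±L_{n+1}, ∓L_{n+2}] a′` for every `n`, `a′`; GEOMETRIC HALF cited (§2 ⇐ and
[KiralyLutkebohmert2013, Thm. 2 (d) ⇒ (a)]): no Perron chart of the control is a pseudo-reflection model and none has
a regular ring of invariants — luck is NECESSARY for the monomial mechanism (`p = 7`, `γ = [0; 4, 2̄]`: residues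
`1, 4, 2` — desk).  TYPED COMPLEMENT KINDS (PART C′, tag UNDECIDED, docstring TESTS): `WildLogDiagonalUnluckyAbove`
(λ′: binomial shape, luck not asserted ⊇ cell, `wildLogDiagonalUnluckyAbove_of_wildLogDiagonalLUAbove`) and
`WildLogDiagonalMixedAbove` (λ″: `g x′_j = x′_j u_j`, `u_j ∈ B^×` ⊇ λ′,
`wildLogDiagonalMixedAbove_of_wildLogDiagonalUnluckyAbove`, which USES `one_add_zpow_ne_one`: `1 + η` is no root of
unity in characteristic `p`).

§6 HONEST SCOPE.  (i) a SUB-KIND of the wild `ℤ/p` kind — binomial log-diagonal with `p`-lucky frames on cofinal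
models — DECIDED hypothesis-free by PRODUCTION; descent through g31 / KL13 by name.  (ii) the binder
`¬ WildLogDiagonalLUAbove` of R33 is IMPLIED by R32's `¬ WildPseudoReflectionLUAbove`
(`not_wildLogDiagonalLUAbove_of_not_wildPseudoReflectionLUAbove`) hence by R31's `¬ UnramifiedWitnessLUAbove`: the
CLASS of places of R33 = class of R32 = class of R31 — what is new is the MECHANISM deciding a typed wild kind with NO
model-side regularity / principality surrogate: the pseudo-reflection generator is COMPUTED from `(N, a′, p)`.
(iii) inside the log-diagonal world the remainder is TYPED (§5): unlucky binomial tops (a law must modify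
non-monomially or resolve the singular quotient downstairs: `d = 2` Lipman, `d = 3` [CossartPiltant2019], `d ≥ 4`
OPEN — IDEA-NEEDED, not claimed) and mixed-unit tops.  (iv) R32's remainder (β′) isolated fixed points / moderately
ramified actions ([LorenziniSchroer2019, Def. 6.9, Thm. 6.10] — the ADDITIVE twin `g x = x + …`, opposite geometry,
never of this shape), (β″) non-cyclic `p`-inertia, (γ) defect, (B′), (α3′) — unchanged.

§7 CUT / ROOT (PART D).  R33 `NonKHToricArchLUKeyHenselDescentQuotTInertTwoMBWildLD e c n` := R32's binders
VERBATIM + `¬ WildLogDiagonalLUAbove k O`; the cell piece `…MBWildLDCell` (+ `_holds`, by the law);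
`…MBWild_iff_logDiag : R32 ↔ R33` (the ONE equivalence: case split + law); `…MBWild_of_logDiag` (binder implied);
re-locations `…_iff_logDiag` from R31, R30, R29, R28, R25, R23 and `nonKHToricArchLU_iff_logDiag`; `…WildLD_of_root`;
`closes_logDiag` with `closes_mb`'s FIVE PRINTED binders (`hN ↦ ∀ d ≥ 4, R33 3 3 d`) over the landed `closes_wild`;
`root_iff_logDiag_sigma`.  COSTUME DIFF: vs g31 `WildPseudoReflectionLUAbove` — its clause «`∃ y, ∀ b, g b − b ∈
(g y − y)B`» (KL (a)) is ABSENT here and DERIVED; vs g25 `TameEquivariantLUAbove` / g29 `TameOverInertLUAbove` —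
`[K′:K] = char k` (wild) where they need `([K′:K] : k) ≠ 0`; vs g30 `MonomialBlowupAbove` — a Galois layer and an
action, no blow-up tower below; vs g27 `UnramifiedWitnessLUAbove` — implied (ii), not conversely by automation
(probes N).  TAGS: cell DECIDED (law); kinds λ′, λ″ UNDECIDED (tests); R33 UNDECIDED·WEAKER·located `(3,3,4)`;
`closes_logDiag` CONDITIONAL on the five printed binders, by design.
SOURCES: [KiralyLutkebohmert2013] F. Király, W. Lütkebohmert, Group actions of prime order on local normal rings,
Algebra Number Theory 7 (2013) 63–74 = arXiv:1001.1945 (Def. 1, Thm. 2, Ex. 6 p. 66, Conj. 10); [CossartPiltant2008]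
Lemma 9.4 / N1–N2 (wild invariants of a normal crossing); [LorenziniSchroer2019] = arXiv:1904.08371, Def. 6.9,
Thm. 6.10, Rem. 6.20; [Artin1975] wild `ℤ/p` quotient singularities; [CossartPiltant2019] (the `d = 3` floor);
Perron / Zariski continuants (g31 registry NODE-g31 §4b).  HYGIENE: problem side, sorry-free, standard axioms, zero
fact binders on the law; no instance / notation / macro; every heavy theorem carries `set_option maxHeartbeats … in`
BEFORE its docstring — keep it when slicing; imports the LANDED `…Theorems.WildReflectionLU3` only (+ HarnessLib).
-/

noncomputable section

open Literature.AlgebraicGeometry.Resolution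
open Summit.ResolutionOfSingularities.ResolutionOfSingularities.Theorems.InertDescentLU
open Summit.ResolutionOfSingularities.ResolutionOfSingularities.Theorems.InvariantDescentLU
open Summit.ResolutionOfSingularities.ResolutionOfSingularities.Theorems.WildReflectionLU

universe u

namespace Summit.ResolutionOfSingularities.ResolutionOfSingularities.Theorems.WildLogDiagonalLU

variable {E : Type u} [Field E]

/-! ## PART A — KERNEL ALGEBRA of binomial twists `x ↦ x·(1 + η)^N` -/

section Frobenius

/-- `(1 + η)^n − 1 = η · Σ_{i<n} (1 + η)^i`. [folklore] -/
theorem one_add_pow_sub_one (η : E) (n : ℕ) :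
    (1 + η) ^ n - 1 = η * ∑ i ∈ Finset.range n, (1 + η) ^ i := by
  have h := geom_sum_mul (1 + η) n
  rw [add_sub_cancel_left] at h
  rw [← h, mul_comm]

/-- The geometric sum `Σ_{i<n} (1 + η)^i` lies in any subring containing `η`. [folklore] -/
theorem geom_sum_mem (B : Subring E) {η : E} (hη : η ∈ B) (n : ℕ) :
    ∑ i ∈ Finset.range n, (1 + η) ^ i ∈ B :=
  B.sum_mem fun i _ => B.pow_mem (B.add_mem B.one_mem hη) i

/-- `Σ_{i<n} (1 + η)^i = n + η·(Σ_{i<n} Σ_{j<i} (1 + η)^j)`: the geometric sum is `n` modulo `η`. [folklore] -/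
theorem geom_sum_eq_natCast_add (η : E) (n : ℕ) :
    ∑ i ∈ Finset.range n, (1 + η) ^ i =
      n + η * ∑ i ∈ Finset.range n, ∑ j ∈ Finset.range i, (1 + η) ^ j := by
  have e : ∀ i, (1 + η) ^ i = 1 + η * ∑ j ∈ Finset.range i, (1 + η) ^ j := fun i => by
    rw [← one_add_pow_sub_one]; ring
  calc ∑ i ∈ Finset.range n, (1 + η) ^ i
      = ∑ i ∈ Finset.range n, (1 + η * ∑ j ∈ Finset.range i, (1 + η) ^ j) :=
        Finset.sum_congr rfl fun i _ => e i
    _ = n + η * ∑ i ∈ Finset.range n, ∑ j ∈ Finset.range i, (1 + η) ^ j := by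
        rw [Finset.sum_add_distrib, Finset.sum_const, Finset.card_range, Finset.mul_sum]
        simp

variable (O : ValuationSubring E)

/-- In characteristic `p`, a natural number prime to `p` is a UNIT of every valuation ring (it is invertible in
the prime field `𝔽_p ⊆ O`). [folklore] -/
theorem valuation_natCast_eq_one (p : ℕ) [hp : Fact p.Prime] [CharP E p] {n : ℕ} (hn : ¬ p ∣ n) :
    O.valuation (n : E) = 1 := by
  have hcop : Nat.Coprime n p := (Nat.coprime_comm.mp ((Nat.Prime.coprime_iff_not_dvd hp.out).mpr hn))
  obtain ⟨m, -, hm⟩ := Nat.exists_mul_mod_eq_one_of_coprime hcop hp.out.one_lt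
  have hnm : (n : E) * (m : E) = 1 := by
    have h := Nat.mod_add_div (n * m) p
    rw [hm] at h
    have h' : ((n * m : ℕ) : E) = ((1 + p * (n * m / p) : ℕ) : E) := by rw [h]
    rw [Nat.cast_mul, Nat.cast_add, Nat.cast_mul, CharP.cast_eq_zero E p, zero_mul, add_zero,
      Nat.cast_one] at h'
    exact h'
  have hvn : O.valuation (n : E) ≤ 1 := (O.valuation_le_one_iff _).mpr (natCast_mem O n)
  have hvm : O.valuation (m : E) ≤ 1 := (O.valuation_le_one_iff _).mpr (natCast_mem O m)
  refine le_antisymm hvn (not_lt.mp fun hlt => ?_)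
  have h1 : O.valuation ((n : E) * (m : E)) < 1 := by
    rw [map_mul]
    exact mul_lt_one_of_lt_of_le hlt hvm
  rw [hnm, map_one] at h1
  exact lt_irrefl _ h1

/-- `v(η) < 1` and `v(n) = 1` give `v(Σ_{i<n} (1 + η)^i) = 1`. [folklore] -/
theorem valuation_geom_sum_eq_one {η : E} (hηO : η ∈ O) (hηv : O.valuation η < 1) {n : ℕ}
    (hn : O.valuation (n : E) = 1) : O.valuation (∑ i ∈ Finset.range n, (1 + η) ^ i) = 1 := by
  rw [geom_sum_eq_natCast_add]
  set s : E := ∑ i ∈ Finset.range n, ∑ j ∈ Finset.range i, (1 + η) ^ j with hs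
  have hsO : s ∈ O := sum_mem fun i _ => sum_mem fun j _ => pow_mem (add_mem O.one_mem hηO) j
  have hlt : O.valuation (η * s) < O.valuation (n : E) := by
    rw [hn, map_mul]
    exact mul_lt_one_of_lt_of_le hηv ((O.valuation_le_one_iff _).mpr hsO)
  rw [Valuation.map_add_eq_of_lt_left _ hlt, hn]

/-- `v(η) < 1 ⇒ v(1 + η) = 1`, in particular `1 + η ≠ 0`. [folklore] -/
theorem valuation_one_add_eq_one {η : E} (hηv : O.valuation η < 1) : O.valuation (1 + η) = 1 := by
  rw [← O.valuation.map_one] at hηv ⊢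
  exact Valuation.map_add_eq_of_lt_left _ hηv

/-- FROBENIUS: `(1 + η)^{p^e} = 1 + η^{p^e}` in characteristic `p`. [folklore] -/
theorem one_add_pow_prime_pow (p : ℕ) [Fact p.Prime] [CharP E p] (η : E) (e : ℕ) :
    (1 + η) ^ p ^ e = 1 + η ^ p ^ e := by
  rw [add_pow_char_pow, one_pow]

/-- **FROBENIUS NORMAL FORM of a binomial twist** (where «wild» is used): in characteristic `p`, for `η` of positive
value in a subring `B ⊆ O` of a valued field containing `(1 + η)⁻¹`, and `N = p^e · m` with `p ∤ m`,
`(1 + η)^N − 1 = η^{p^e} · c` with `c ∈ B` a UNIT of `O` (`c ≡ m (mod 𝔪_O)`): the augmentation of a coordinate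
twisted by `(1 + η)^N` has the exact order `p^{v_p(N)}` in `η`.  [cite: KiralyLutkebohmert2013, Ex. 6, p. 66] -/
theorem exists_one_add_zpow_sub_one_eq (p : ℕ) [hp : Fact p.Prime] [CharP E p] (B : Subring E)
    (hBO : B ≤ O.toSubring) {η : E} (hη : η ∈ B) (hηv : O.valuation η < 1) (hinv : (1 + η)⁻¹ ∈ B)
    (e : ℕ) {m : ℤ} (hm : ¬ (p : ℤ) ∣ m) :
    ∃ c ∈ B, O.valuation c = 1 ∧ (1 + η) ^ ((p : ℤ) ^ e * m) - 1 = η ^ p ^ e * c := by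
  have hηO : η ∈ O := hBO hη
  -- pass to `η′ := η^{p^e}`: `(1 + η)^{p^e m} = (1 + η′)^m`
  set η' : E := η ^ p ^ e with hη'
  have hη'B : η' ∈ B := B.pow_mem hη _
  have hη'O : η' ∈ O := pow_mem hηO _
  have hη'v : O.valuation η' < 1 := by
    rw [hη', map_pow]
    exact pow_lt_one₀ zero_le hηv (pow_ne_zero _ hp.out.ne_zero)
  have h1 : (1 + η) ≠ 0 := ne_zero_of_valuation_eq_one (valuation_one_add_eq_one O hηv)
  have h1' : (1 + η') ≠ 0 := ne_zero_of_valuation_eq_one (valuation_one_add_eq_one O hη'v)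
  have hfrob : (1 + η) ^ p ^ e = 1 + η' := one_add_pow_prime_pow p η e
  have hinv' : (1 + η')⁻¹ ∈ B := by
    rw [← hfrob, ← inv_pow]
    exact B.pow_mem hinv _
  have hinv'v : O.valuation (1 + η')⁻¹ = 1 := by
    rw [map_inv₀, valuation_one_add_eq_one O hη'v, inv_one]
  have hpow : (1 + η) ^ ((p : ℤ) ^ e * m) = (1 + η') ^ m := by
    rw [zpow_mul, ← hfrob]
    congr 1
    exact_mod_cast zpow_natCast (1 + η) (p ^ e)
  rw [hpow]
  -- case split on the sign of `m`
  obtain ⟨n, rfl | rfl⟩ := m.eq_nat_or_neg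
  · have hn : ¬ p ∣ n := fun h => hm (by exact_mod_cast h)
    refine ⟨∑ i ∈ Finset.range n, (1 + η') ^ i, geom_sum_mem B hη'B n,
      valuation_geom_sum_eq_one O hη'O hη'v (valuation_natCast_eq_one O p hn), ?_⟩
    rw [zpow_natCast]
    exact one_add_pow_sub_one η' n
  · have hn : ¬ p ∣ n := fun h => hm (by rw [dvd_neg]; exact_mod_cast h)
    refine ⟨-((1 + η')⁻¹ ^ n * ∑ i ∈ Finset.range n, (1 + η') ^ i),
      B.neg_mem (B.mul_mem (B.pow_mem hinv' n) (geom_sum_mem B hη'B n)), ?_, ?_⟩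
    · rw [Valuation.map_neg, map_mul, map_pow, hinv'v, one_pow, one_mul]
      exact valuation_geom_sum_eq_one O hη'O hη'v (valuation_natCast_eq_one O p hn)
    · rw [zpow_neg, zpow_natCast, ← inv_pow]
      have h2 : (1 + η')⁻¹ ^ n * (1 + η') ^ n = 1 := by
        rw [← mul_pow, inv_mul_cancel₀ h1', one_pow]
      calc (1 + η')⁻¹ ^ n - 1 = -((1 + η')⁻¹ ^ n * ((1 + η') ^ n - 1)) := by
            rw [mul_sub, h2, mul_one, neg_sub]
        _ = η' * -((1 + η')⁻¹ ^ n * ∑ i ∈ Finset.range n, (1 + η') ^ i) := by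
            rw [one_add_pow_sub_one]; ring

/-- `p`-adic splitting of a non-zero integer: `m = p^f · m′` with `p ∤ m′`. [folklore] -/
theorem exists_eq_prime_pow_mul_not_dvd (p : ℕ) [hp : Fact p.Prime] {m : ℤ} (hm0 : m ≠ 0) :
    ∃ f : ℕ, ∃ m' : ℤ, ¬ (p : ℤ) ∣ m' ∧ m = (p : ℤ) ^ f * m' := by
  have hp1 : (p : ℤ) ≠ 1 := by exact_mod_cast hp.out.one_lt.ne'
  have hfin : FiniteMultiplicity (p : ℤ) m := FiniteMultiplicity.of_not_isUnit
    (by rw [Int.isUnit_iff]; omega) hm0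
  obtain ⟨m', hmm⟩ := pow_multiplicity_dvd (p : ℤ) m
  refine ⟨multiplicity (p : ℤ) m, m', fun hd => ?_, hmm⟩
  have h2 : (p : ℤ) ^ (multiplicity (p : ℤ) m + 1) ∣ (p : ℤ) ^ multiplicity (p : ℤ) m * m' := by
    rw [pow_succ]
    exact mul_dvd_mul_left _ hd
  rw [← hmm] at h2
  exact hfin.not_pow_dvd_of_multiplicity_lt (lt_add_one _) h2

/-- The same normal form WITHOUT the unit information, for an arbitrary exponent `p^e · m`. [folklore] -/
theorem exists_one_add_zpow_sub_one_eq' (p : ℕ) [hp : Fact p.Prime] [CharP E p] (B : Subring E)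
    (hBO : B ≤ O.toSubring) {η : E} (hη : η ∈ B) (hηv : O.valuation η < 1) (hinv : (1 + η)⁻¹ ∈ B)
    (e : ℕ) (m : ℤ) : ∃ c ∈ B, (1 + η) ^ ((p : ℤ) ^ e * m) - 1 = η ^ p ^ e * c := by
  by_cases hm0 : m = 0
  · exact ⟨0, B.zero_mem, by rw [hm0, mul_zero, zpow_zero, sub_self, mul_zero]⟩
  -- write `m = p^f · m′` with `p ∤ m′` and absorb `p^f` into the Frobenius exponent
  obtain ⟨f, m', hm', hmm⟩ := exists_eq_prime_pow_mul_not_dvd p hm0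
  obtain ⟨c, hcB, -, hc⟩ := exists_one_add_zpow_sub_one_eq O p B hBO hη hηv hinv (e + f) hm'
  refine ⟨η ^ (p ^ (e + f) - p ^ e) * c, B.mul_mem (B.pow_mem hη _) hcB, ?_⟩
  have hexp : (p : ℤ) ^ e * m = (p : ℤ) ^ (e + f) * m' := by rw [hmm, pow_add, mul_assoc]
  have hle : p ^ e ≤ p ^ (e + f) := Nat.pow_le_pow_right hp.out.pos (Nat.le_add_right e f)
  rw [hexp, hc, ← mul_assoc, ← pow_add, Nat.add_sub_cancel' hle]

/-- **`1 + η` IS NEVER A ROOT OF UNITY** (`v(η) > 0`, `η ≠ 0`, characteristic `p`): `(1 + η)^N ≠ 1` for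
`N ≠ 0` — by the Frobenius normal form `(1 + η)^N − 1 = η^{p^{v_p N}}·(unit)`.  This is what makes a binomial
log-diagonal twist with `N_j ≠ 0` MOVE the coordinate `x′_j`. [folklore] -/
theorem one_add_zpow_ne_one (p : ℕ) [hp : Fact p.Prime] [CharP E p] {η : E} (hηO : η ∈ O)
    (hηv : O.valuation η < 1) (hη0 : η ≠ 0) {N : ℤ} (hN : N ≠ 0) : (1 + η) ^ N ≠ 1 := by
  obtain ⟨f, m', hm', hmm⟩ := exists_eq_prime_pow_mul_not_dvd p hN
  have hinv : (1 + η)⁻¹ ∈ O.toSubring := by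
    rw [ValuationSubring.mem_toSubring, ← ValuationSubring.valuation_le_one_iff, map_inv₀,
      valuation_one_add_eq_one O hηv, inv_one]
  obtain ⟨c, -, hcv, hc⟩ := exists_one_add_zpow_sub_one_eq O p O.toSubring le_rfl hηO hηv hinv f hm'
  intro h
  have : η ^ p ^ f * c = 0 := by rw [← hc, ← hmm, h, sub_self]
  exact mul_ne_zero (pow_ne_zero _ hη0) (ne_zero_of_valuation_eq_one hcv) this

end Frobenius

/-! ### The derivation rule `I(ab) = I(a)·σb + a·I(b)` along a subring closure -/

section Derivation

variable {σ : E ≃+* E} {B : Subring E}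

/-- **DERIVATION RULE.** If `σ` preserves a subring `B` and every generator `z ∈ s` lies in `B` with
`σ z − z ∈ δ·B`, then so does every element of the subring generated by `s`
(`I(ab) = I(a)·σ(b) + a·I(b)`, `I(a + b) = I(a) + I(b)`): the set `{z ∈ B | σ z − z ∈ δ B}` is a subring.
[cite: KiralyLutkebohmert2013, Rem. 3, p. 65] -/
theorem apply_sub_mem_of_mem_closure (hσB : ∀ z ∈ B, σ z ∈ B) (δ : E) {s : Set E}
    (hs : ∀ z ∈ s, z ∈ B ∧ ∃ c ∈ B, σ z - z = δ * c) {z : E} (hz : z ∈ Subring.closure s) :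
    z ∈ B ∧ ∃ c ∈ B, σ z - z = δ * c := by
  induction hz using Subring.closure_induction with
  | mem x hx => exact hs x hx
  | zero => exact ⟨B.zero_mem, 0, B.zero_mem, by simp⟩
  | one => exact ⟨B.one_mem, 0, B.zero_mem, by simp⟩
  | add x y _ _ hx hy =>
      obtain ⟨hxB, c, hc, ec⟩ := hx
      obtain ⟨hyB, c', hc', ec'⟩ := hy
      exact ⟨B.add_mem hxB hyB, c + c', B.add_mem hc hc', by rw [map_add]; linear_combination ec + ec'⟩
  | neg x _ hx =>
      obtain ⟨hxB, c, hc, ec⟩ := hx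
      exact ⟨B.neg_mem hxB, -c, B.neg_mem hc, by rw [map_neg]; linear_combination -ec⟩
  | mul x y _ _ hx hy =>
      obtain ⟨hxB, c, hc, ec⟩ := hx
      obtain ⟨hyB, c', hc', ec'⟩ := hy
      exact ⟨B.mul_mem hxB hyB, c * σ y + x * c', B.add_mem (B.mul_mem hc (hσB y hyB)) (B.mul_mem hxB hc'),
        by rw [map_mul]; linear_combination (σ y) * ec + x * ec'⟩

end Derivation

end Summit.ResolutionOfSingularities.ResolutionOfSingularities.Theorems.WildLogDiagonalLU

end
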